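import Mathlib
import HarnessLib
import Summits.HubbardSuperconductivity.HubbardSuperconductivity.Theorems.KLProgrammeKLRegimeVolumeLimitSecondOrderRateSymbols
import Summits.HubbardSuperconductivity.HubbardSuperconductivity.Theorems.KLProgrammeKLRegimeVolumeLimitRateEx
import Summits.HubbardSuperconductivity.HubbardSuperconductivity.Theorems.KLProgrammeKLRegimeVolumeLimitZeroCouplingRate

/-!
# Route `KLProgramme` — VL child `KLRegimeVolumeLimitV12` (stmt-HubbardSuperconductivity-19858), Cauchy stub `stub_vl_twoVolumeRate`:
# the order-`U²` rung of the TRUE carrier, PART 2/2 — **the second-order Taylor truncation in the coupling of the VL carrier satisfies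
# the REGISTERED two-volume inequality for every admissible frame** (cell gate-hubbard-kl, seat hubbard-kl-k3c4-p1 g4; the Cauchy-form
# twin of k3c5-p3's `secondOrderTaylor_volLimit`)

THE THEOREM `secondOrderTaylor_twoVolumeRate_of_frameOK`: for every `β > 0`, every `U`, `μ` and every ADMISSIBLE frame `K`
(`FrameOK R U₁ N μ K`) there are thresholds `L₀`, `Mth`, a constant `D` and a rate `ρ → 0` such that the degree-two Taylor polynomial in
the coupling of the carrier of the VL text,
`T₂Σ̂^K_{L,M}(k,σ;U) = Σ̂^K_{L,M}(k,σ;0) + U·∂_UΣ̂^K_{L,M}(k,σ;0) + (U²/2)·∂_U²Σ̂^K_{L,M}(k,σ;0)`,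
obeys `‖T₂Σ̂^K_{L,M}((ω,k),σ) − T₂Σ̂^K_{L′,M′}((ω′,k′),σ)‖ ≤ ρ L + D·Σ_i |p_k i − p′_{k′} i|_𝕋` for all `L₀ ≤ L ≤ L′`, `Mth L ≤ M`,
`Mth L′ ≤ M′`, equal Matsubara integers and all torus momenta — the inequality of the registered stub `stub_vl_twoVolumeRate` of the
skeleton «cauchy», for this truncation of the true carrier.

ASSEMBLY (the `Rate∃` algebra of `…VolumeLimitRateEx`, common thresholds): order `U⁰` = `zeroCoupling_twoVolumeRate_of_frameOK`
(grid-exact, `ρ ≡ 0`); order `U¹` = `−d²·t` with the tadpole average `t` a momentum-constant family with an iterated limit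
(`tadpoleAvg_iterLimit` ⇒ `klre_of_iterLimit`) dressed by the squared dressing symbol `d²` (`klso_dressSq_*`, `klre_dressing_mul`);
order `U²` = `2·d²·(klSunset(g₀) − g₀·t·t − t·t₂)` with the SUNSET RATE `klSunset_bare_twoVolumeRate` (PART `…SunsetRate`), the
one-loop average `t₂` (`sqAvg_iterLimit`), the bare symbol `g₀` as a dressing, products/differences (`klre_mul`, `klre_sub`), then the
`d²` dressing and the constants `2`, `U`, `U²/2`; the carrier is rewritten into this form by `klso_deriv_eq` / `klso_deriv_deriv_eq`.
Bounds used: `‖klSunset‖ ≤ B` (g0's `klSunset_volLimit`), `‖t‖ ≤ ½` (`norm_tadpoleAvg_le`), `‖t₂‖ ≤ A` (`sqAvg_iterLimit`), `‖g₀‖ ≤ β/π`,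
`‖d²‖ ≤ (1 + ‖K‖₀β/π)²`.  Nothing is asserted about the full carrier beyond its Taylor data at `U = 0`.
-/

noncomputable section

namespace Summit.HubbardSuperconductivity.HubbardSuperconductivity.Theorems.KLRegimeSplit

set_option linter.dupNamespace false -- summit = problem name (single-conjunct summit), D-0017

open Filter Topology Finset Real Literature.MathematicalPhysics.QuantumLattice Literature.Probability.LatticeModels
open Literature.MathematicalPhysics.QuantumLattice.FermiRG
open Summit.HubbardSuperconductivity.HubbardSuperconductivity.Theorems.DispersionFlow
open Summit.HubbardSuperconductivity.HubbardSuperconductivity.Theorems.KLProgrammeLegKernels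
open Summit.HubbardSuperconductivity.HubbardSuperconductivity.Theorems.TwoPointAssembly

/-- **THE ORDER-`U²` TAYLOR TRUNCATION OF THE TRUE CARRIER SATISFIES THE REGISTERED CAUCHY STUB'S INEQUALITY** for every `β > 0`, `U`, `μ`
and every admissible frame (`FrameOK R U₁ N μ K`): `∃ L₀ Mth D ρ, ρ → 0 ∧ ∀ L ≥ L₀ ∀ M ≥ Mth L ∀ L′ ≥ L ∀ M′ ≥ Mth L′ ∀ σ ω ω′` (equal
Matsubara integers) `∀ k k′`, `‖T₂Σ̂_{L,M}((ω,k),σ) − T₂Σ̂_{L′,M′}((ω′,k′),σ)‖ ≤ ρ L + D·Σ_i |p_k i − p′_{k′} i|_𝕋`. -/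
theorem secondOrderTaylor_twoVolumeRate_of_frameOK {β : ℝ} (hβ : 0 < β) (U : ℝ) {R : RenConsts} {U₁ : ℝ} {N : ℕ} {μ : ℝ}
    {K : TrigPolyC4v} (hK : FrameOK R U₁ N μ K) :
    ∃ L₀ : ℕ, ∃ Mth : ℕ → ℕ, ∃ D : ℝ, ∃ ρ : ℕ → ℝ, Tendsto ρ atTop (𝓝 0) ∧
      ∀ (L : ℕ) [NeZero L], L₀ ≤ L → ∀ (M : ℕ) [NeZero M], Mth L ≤ M →
        ∀ (L' : ℕ) [NeZero L'], L ≤ L' → ∀ (M' : ℕ) [NeZero M'], Mth L' ≤ M' →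
          ∀ (σ : Fin 2) (ω : MatsubaraIdx M) (ω' : MatsubaraIdx M'), matsubaraInt M ω = matsubaraInt M' ω' →
            ∀ (k : TorusSite 2 L) (k' : TorusSite 2 L'),
              ‖(klSelfEnergy L M β 0 μ K klE0 (nScales β + 1) (ω, k) σ +
                    (U : ℂ) * deriv (fun U' : ℝ => klSelfEnergy L M β U' μ K klE0 (nScales β + 1) (ω, k) σ) 0 +
                  ((U ^ 2 / 2 : ℝ) : ℂ) *
                    deriv (deriv fun U' : ℝ => klSelfEnergy L M β U' μ K klE0 (nScales β + 1) (ω, k) σ) 0) -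
                (klSelfEnergy L' M' β 0 μ K klE0 (nScales β + 1) (ω', k') σ +
                    (U : ℂ) * deriv (fun U' : ℝ => klSelfEnergy L' M' β U' μ K klE0 (nScales β + 1) (ω', k') σ) 0 +
                  ((U ^ 2 / 2 : ℝ) : ℂ) *
                    deriv (deriv fun U' : ℝ => klSelfEnergy L' M' β U' μ K klE0 (nScales β + 1) (ω', k') σ) 0)‖ ≤
              ρ L + D * ∑ i, torusAbs (latticeMomentum L k i - latticeMomentum L' k' i) := by
  -- the two symbols
  set g0 : ℤ → (Fin 2 → ℝ) → ℂ := fun n p => ((bandCT μ 0 p : ℂ) - Complex.I * (fermiMatsubara β n : ℂ))⁻¹ with hg0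
  set dsq : ℤ → (Fin 2 → ℝ) → ℂ := fun n p =>
    (1 - (K.eval p : ℂ) * ((bandCT μ 0 p : ℂ) - Complex.I * (fermiMatsubara β n : ℂ))⁻¹) ^ 2 with hdsq
  have hK0 : 0 ≤ K.coeffNorm 0 := TrigPolyC4v.coeffNorm_nonneg 0 K
  set Bd : ℝ := 1 + K.coeffNorm 0 * (β / Real.pi) with hBd
  set Ld : ℝ := (4 + 7 * Real.sqrt 2) * (β / Real.pi) + K.coeffNorm 0 * (4 * β ^ 2 / π ^ 2) with hLd
  have hBd0 : 0 ≤ Bd := by positivity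
  have hLd0 : 0 ≤ Ld := by positivity
  -- symbol data
  have hg0b : ∀ (n : ℤ) (p : Fin 2 → ℝ), ‖g0 n p‖ ≤ β / Real.pi := fun n p => norm_bareSymbol_le hβ μ n p
  have hg0per : ∀ (n : ℤ) (p : Fin 2 → ℝ) (m : Fin 2 → ℤ), g0 n (fun i => p i + m i * (2 * Real.pi)) = g0 n p :=
    fun n p m => klso_bareSymbol_periodic β μ n p m
  have hg0lip : ∀ (n : ℤ) (p q : Fin 2 → ℝ), ‖g0 n p - g0 n q‖ ≤ 4 * β ^ 2 / π ^ 2 * ‖p - q‖ :=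
    fun n p q => klso_bareSymbol_sub_le hβ μ n p q
  have hdsqb : ∀ (n : ℤ) (p : Fin 2 → ℝ), ‖dsq n p‖ ≤ Bd ^ 2 := fun n p => klso_dressSq_norm_le hβ μ K n p
  have hdsqper : ∀ (n : ℤ) (p : Fin 2 → ℝ) (m : Fin 2 → ℤ), dsq n (fun i => p i + m i * (2 * Real.pi)) = dsq n p :=
    fun n p m => klso_dressSq_periodic β μ K n p m
  have hdsqlip : ∀ (n : ℤ) (p q : Fin 2 → ℝ), ‖dsq n p - dsq n q‖ ≤ 2 * Bd * Ld * ‖p - q‖ :=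
    fun n p q => klso_dressSq_sub_le hβ hK n p q
  -- (1) the sunset piece: rate and bound
  obtain ⟨Ls, Ms, Ds, ρs, hρs, hs⟩ := klSunset_bare_twoVolumeRate hβ μ
  obtain ⟨_, Bs, Lb, _, hBs, _⟩ := klSunset_volLimit hβ (g := g0) (C := β / (2 * π)) (by positivity)
    (fun a => klfs_frameSymbol_continuous hβ μ 0 a) (fun a x m => klfs_frameSymbol_periodic β μ 0 a x m)
    (fun a x => klfs_frameSymbol_norm_le hβ μ 0 a x) (fun L => L)
  -- (2) the tadpole average and the one-loop average: iterated limits ⇒ rates; bounds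
  obtain ⟨tInf, htl⟩ := tadpoleAvg_iterLimit hβ μ
  obtain ⟨Lt, Mt, Dt, ρt, hρt, ht⟩ := klre_of_iterLimit htl
  obtain ⟨t2Inf, A2, hA2, ht2l⟩ := sqAvg_iterLimit hβ μ
  obtain ⟨Lt2, Mt2, Dt2, ρt2, hρt2, ht2⟩ := klre_of_iterLimit ht2l
  have hA20 : 0 ≤ A2 := (norm_nonneg _).trans (hA2 1 1)
  -- (3) the zero-coupling piece
  have h0 := zeroCoupling_twoVolumeRate_of_frameOK hβ hK
  -- common thresholds
  set Lc : ℕ := max (max Ls Lb) (max Lt Lt2) with hLc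
  set Mc : ℕ → ℕ := fun L => max (max (Ms L) L) (max (Mt L) (Mt2 L)) with hMc
  have hLs : Ls ≤ Lc := (le_max_left _ _).trans (le_max_left _ _)
  have hLb : Lb ≤ Lc := (le_max_right _ _).trans (le_max_left _ _)
  have hLt : Lt ≤ Lc := (le_max_left _ _).trans (le_max_right _ _)
  have hLt2 : Lt2 ≤ Lc := (le_max_right _ _).trans (le_max_right _ _)
  have hMs : ∀ L, Ms L ≤ Mc L := fun L => (le_max_left _ _).trans (le_max_left _ _)
  have hMid : ∀ L, L ≤ Mc L := fun L => (le_max_right _ _).trans (le_max_left _ _)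
  have hMt : ∀ L, Mt L ≤ Mc L := fun L => (le_max_left _ _).trans (le_max_right _ _)
  have hMt2 : ∀ L, Mt2 L ≤ Mc L := fun L => (le_max_right _ _).trans (le_max_right _ _)
  -- the pieces at the common thresholds
  have hsun : _ := klre_mono (S := fun L M _ _ k σ => klSunset L M β g0 k σ) hLs hMs ⟨Ds, ρs, hρs, hs⟩
  have htc : _ := klre_mono (S := fun L M _ _ _ _ => (∑ q : FreqMomentum L M, propCT L M β μ 0 q) / ((β * (L : ℝ) ^ 2 : ℝ) : ℂ))
    hLt hMt ⟨Dt, ρt, hρt, ht⟩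
  have ht2c : _ := klre_mono (S := fun L M _ _ _ _ => (∑ q : FreqMomentum L M, propCT L M β μ 0 q ^ 2) / ((β * (L : ℝ) ^ 2 : ℝ) : ℂ))
    hLt2 hMt2 ⟨Dt2, ρt2, hρt2, ht2⟩
  have h0c : _ := klre_mono (S := fun L M _ _ k σ => klSelfEnergy L M β 0 μ K klE0 (nScales β + 1) k σ) (L₀' := Lc) (Mth' := Mc)
    (Nat.zero_le _) (fun L => Nat.zero_le _) ⟨_, fun _ : ℕ => (0 : ℝ), tendsto_const_nhds, h0⟩
  -- bounds beyond the common thresholds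
  have hb_sun : ∀ (L : ℕ) [NeZero L], Lc ≤ L → ∀ (M : ℕ) [NeZero M], Mc L ≤ M → ∀ (k : FreqMomentum L M) (σ : Fin 2),
      ‖klSunset L M β g0 k σ‖ ≤ max Bs 0 := fun L _ hL M _ hM k σ =>
    (hBs L (hLb.trans hL) M ((hMid L).trans hM) k σ).trans (le_max_left _ _)
  have hb_t : ∀ (L : ℕ) [NeZero L], Lc ≤ L → ∀ (M : ℕ) [NeZero M], Mc L ≤ M → ∀ (_k : FreqMomentum L M) (_σ : Fin 2),
      ‖(∑ q : FreqMomentum L M, propCT L M β μ 0 q) / ((β * (L : ℝ) ^ 2 : ℝ) : ℂ)‖ ≤ 1 / 2 := fun L _ _ M _ _ _ _ =>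
    norm_tadpoleAvg_le hβ μ
  have hb_t2 : ∀ (L : ℕ) [NeZero L], Lc ≤ L → ∀ (M : ℕ) [NeZero M], Mc L ≤ M → ∀ (_k : FreqMomentum L M) (_σ : Fin 2),
      ‖(∑ q : FreqMomentum L M, propCT L M β μ 0 q ^ 2) / ((β * (L : ℝ) ^ 2 : ℝ) : ℂ)‖ ≤ A2 := fun L _ _ M _ _ _ _ => hA2 L M
  have hb_tt : ∀ (L : ℕ) [NeZero L], Lc ≤ L → ∀ (M : ℕ) [NeZero M], Mc L ≤ M → ∀ (_k : FreqMomentum L M) (_σ : Fin 2),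
      ‖(∑ q : FreqMomentum L M, propCT L M β μ 0 q) / ((β * (L : ℝ) ^ 2 : ℝ) : ℂ) *
          ((∑ q : FreqMomentum L M, propCT L M β μ 0 q) / ((β * (L : ℝ) ^ 2 : ℝ) : ℂ))‖ ≤ 1 / 2 * (1 / 2) := fun L _ _ M _ _ _ _ => by
    rw [norm_mul]
    exact mul_le_mul (norm_tadpoleAvg_le hβ μ) (norm_tadpoleAvg_le hβ μ) (norm_nonneg _) (by norm_num)
  -- (4) the order-U² bracket: t·t, g₀·(t·t), t·t₂, sunset − g₀·(t·t) − t·t₂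
  have htt : _ := klre_mul (BS := 1 / 2) (BT := 1 / 2) (by norm_num) hb_t hb_t htc htc
  have hgtt : _ := klre_dressing_mul
    (S := fun L M _ _ _ _ => (∑ q : FreqMomentum L M, propCT L M β μ 0 q) / ((β * (L : ℝ) ^ 2 : ℝ) : ℂ) *
      ((∑ q : FreqMomentum L M, propCT L M β μ 0 q) / ((β * (L : ℝ) ^ 2 : ℝ) : ℂ)))
    (Φ := fun L M _ _ k => g0 (matsubaraInt M k.1) (latticeMomentum L k.2)) (φ := g0) (Bφ := β / Real.pi)
    (Kφ := 4 * β ^ 2 / π ^ 2) (B := 1 / 2 * (1 / 2)) (by positivity) (by positivity) hg0b hg0per hg0lip (fun _ _ _ _ _ _ => rfl) hb_tt htt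
  have htt2 : _ := klre_mul (BS := 1 / 2) (BT := A2) (by norm_num) hb_t hb_t2 htc ht2c
  have hin1 : _ := klre_sub (S := (fun (L M : ℕ) (_ : NeZero L) (_ : NeZero M) (k : FreqMomentum L M) (σ : Fin 2) =>
        klSunset L M β g0 k σ))
    (T := (fun (L M : ℕ) (_ : NeZero L) (_ : NeZero M) (k : FreqMomentum L M) (_ : Fin 2) =>
        g0 (matsubaraInt M k.1) (latticeMomentum L k.2) *
          (((∑ q : FreqMomentum L M, propCT L M β μ 0 q) / ((β * (L : ℝ) ^ 2 : ℝ) : ℂ)) *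
            ((∑ q : FreqMomentum L M, propCT L M β μ 0 q) / ((β * (L : ℝ) ^ 2 : ℝ) : ℂ))))) hsun hgtt
  have hinner : _ := klre_sub
    (S := (fun (L M : ℕ) (_ : NeZero L) (_ : NeZero M) (k : FreqMomentum L M) (σ : Fin 2) =>
        klSunset L M β g0 k σ - g0 (matsubaraInt M k.1) (latticeMomentum L k.2) *
          (((∑ q : FreqMomentum L M, propCT L M β μ 0 q) / ((β * (L : ℝ) ^ 2 : ℝ) : ℂ)) *
            ((∑ q : FreqMomentum L M, propCT L M β μ 0 q) / ((β * (L : ℝ) ^ 2 : ℝ) : ℂ)))))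
    (T := (fun (L M : ℕ) (_ : NeZero L) (_ : NeZero M) (_ : FreqMomentum L M) (_ : Fin 2) =>
        (∑ q : FreqMomentum L M, propCT L M β μ 0 q) / ((β * (L : ℝ) ^ 2 : ℝ) : ℂ) *
          ((∑ q : FreqMomentum L M, propCT L M β μ 0 q ^ 2) / ((β * (L : ℝ) ^ 2 : ℝ) : ℂ)))) hin1 htt2
  have hb_inner : ∀ (L : ℕ) [NeZero L], Lc ≤ L → ∀ (M : ℕ) [NeZero M], Mc L ≤ M → ∀ (k : FreqMomentum L M) (σ : Fin 2),
      ‖(klSunset L M β g0 k σ -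
            g0 (matsubaraInt M k.1) (latticeMomentum L k.2) *
              ((∑ q : FreqMomentum L M, propCT L M β μ 0 q) / ((β * (L : ℝ) ^ 2 : ℝ) : ℂ) *
                ((∑ q : FreqMomentum L M, propCT L M β μ 0 q) / ((β * (L : ℝ) ^ 2 : ℝ) : ℂ))) -
          (∑ q : FreqMomentum L M, propCT L M β μ 0 q) / ((β * (L : ℝ) ^ 2 : ℝ) : ℂ) *
            ((∑ q : FreqMomentum L M, propCT L M β μ 0 q ^ 2) / ((β * (L : ℝ) ^ 2 : ℝ) : ℂ)))‖ ≤
        max Bs 0 + β / Real.pi * (1 / 2 * (1 / 2)) + 1 / 2 * A2 := by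
    intro L _ hL M _ hM k σ
    have h1 := hb_sun L hL M hM k σ
    have h2 := hb_tt L hL M hM k σ
    have h3 := hb_t L hL M hM k σ
    have h4 := hb_t2 L hL M hM k σ
    have h5 := hg0b (matsubaraInt M k.1) (latticeMomentum L k.2)
    refine (norm_sub_le _ _).trans (add_le_add ((norm_sub_le _ _).trans (add_le_add h1 ?_)) ?_)
    · rw [norm_mul]; exact mul_le_mul h5 h2 (norm_nonneg _) (by positivity)
    · rw [norm_mul]; exact mul_le_mul h3 h4 (norm_nonneg _) (by norm_num)
  -- (5) dress by `d²`, multiply by `2`, `U²/2`; the order-U¹ piece `−d²·t` times `U`; add the zero-coupling piece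
  have hS2 : _ := klre_dressing_mul (S := (fun (L M : ℕ) (_ : NeZero L) (_ : NeZero M) (k : FreqMomentum L M) (σ : Fin 2) =>
        (klSunset L M β g0 k σ -
            g0 (matsubaraInt M k.1) (latticeMomentum L k.2) *
              ((∑ q : FreqMomentum L M, propCT L M β μ 0 q) / ((β * (L : ℝ) ^ 2 : ℝ) : ℂ) *
                ((∑ q : FreqMomentum L M, propCT L M β μ 0 q) / ((β * (L : ℝ) ^ 2 : ℝ) : ℂ))) -
          (∑ q : FreqMomentum L M, propCT L M β μ 0 q) / ((β * (L : ℝ) ^ 2 : ℝ) : ℂ) *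
            ((∑ q : FreqMomentum L M, propCT L M β μ 0 q ^ 2) / ((β * (L : ℝ) ^ 2 : ℝ) : ℂ)))))
    (Φ := fun L M _ _ k => dsq (matsubaraInt M k.1) (latticeMomentum L k.2)) (φ := dsq)
    (Bφ := Bd ^ 2) (Kφ := 2 * Bd * Ld) (by positivity) (by positivity) hdsqb hdsqper hdsqlip (fun _ _ _ _ _ _ => rfl)
    hb_inner hinner
  have hS2a : _ := klre_const_mul (S := (fun (L M : ℕ) (_ : NeZero L) (_ : NeZero M) (k : FreqMomentum L M) (σ : Fin 2) =>
        dsq (matsubaraInt M k.1) (latticeMomentum L k.2) *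
          (klSunset L M β g0 k σ -
            g0 (matsubaraInt M k.1) (latticeMomentum L k.2) *
              ((∑ q : FreqMomentum L M, propCT L M β μ 0 q) / ((β * (L : ℝ) ^ 2 : ℝ) : ℂ) *
                ((∑ q : FreqMomentum L M, propCT L M β μ 0 q) / ((β * (L : ℝ) ^ 2 : ℝ) : ℂ))) -
          (∑ q : FreqMomentum L M, propCT L M β μ 0 q) / ((β * (L : ℝ) ^ 2 : ℝ) : ℂ) *
            ((∑ q : FreqMomentum L M, propCT L M β μ 0 q ^ 2) / ((β * (L : ℝ) ^ 2 : ℝ) : ℂ))))) (2 : ℂ) hS2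
  have hS2' : _ := klre_const_mul (S := (fun (L M : ℕ) (_ : NeZero L) (_ : NeZero M) (k : FreqMomentum L M) (σ : Fin 2) =>
        2 * (dsq (matsubaraInt M k.1) (latticeMomentum L k.2) *
          (klSunset L M β g0 k σ -
            g0 (matsubaraInt M k.1) (latticeMomentum L k.2) *
              ((∑ q : FreqMomentum L M, propCT L M β μ 0 q) / ((β * (L : ℝ) ^ 2 : ℝ) : ℂ) *
                ((∑ q : FreqMomentum L M, propCT L M β μ 0 q) / ((β * (L : ℝ) ^ 2 : ℝ) : ℂ))) -
          (∑ q : FreqMomentum L M, propCT L M β μ 0 q) / ((β * (L : ℝ) ^ 2 : ℝ) : ℂ) *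
            ((∑ q : FreqMomentum L M, propCT L M β μ 0 q ^ 2) / ((β * (L : ℝ) ^ 2 : ℝ) : ℂ))))))
    (((U ^ 2 / 2 : ℝ) : ℂ)) hS2a
  have hS1 : _ := klre_dressing_mul (S := (fun (L M : ℕ) (_ : NeZero L) (_ : NeZero M) (_ : FreqMomentum L M) (_ : Fin 2) =>
        (∑ q : FreqMomentum L M, propCT L M β μ 0 q) / ((β * (L : ℝ) ^ 2 : ℝ) : ℂ)))
    (Φ := fun L M _ _ k => dsq (matsubaraInt M k.1) (latticeMomentum L k.2)) (φ := dsq)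
    (Bφ := Bd ^ 2) (Kφ := 2 * Bd * Ld) (by positivity) (by positivity) hdsqb hdsqper hdsqlip (fun _ _ _ _ _ _ => rfl)
    hb_t htc
  have hS1n : _ := klre_neg (S := (fun (L M : ℕ) (_ : NeZero L) (_ : NeZero M) (k : FreqMomentum L M) (_ : Fin 2) =>
        dsq (matsubaraInt M k.1) (latticeMomentum L k.2) *
          ((∑ q : FreqMomentum L M, propCT L M β μ 0 q) / ((β * (L : ℝ) ^ 2 : ℝ) : ℂ)))) hS1
  have hS1' : _ := klre_const_mul (S := (fun (L M : ℕ) (_ : NeZero L) (_ : NeZero M) (k : FreqMomentum L M) (_ : Fin 2) =>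
        -(dsq (matsubaraInt M k.1) (latticeMomentum L k.2) *
          ((∑ q : FreqMomentum L M, propCT L M β μ 0 q) / ((β * (L : ℝ) ^ 2 : ℝ) : ℂ))))) (U : ℂ) hS1n
  have hsum1 : _ := klre_add (S := (fun (L M : ℕ) (_ : NeZero L) (_ : NeZero M) (k : FreqMomentum L M) (σ : Fin 2) =>
        klSelfEnergy L M β 0 μ K klE0 (nScales β + 1) k σ))
    (T := (fun (L M : ℕ) (_ : NeZero L) (_ : NeZero M) (k : FreqMomentum L M) (_ : Fin 2) =>
        (U : ℂ) * -(dsq (matsubaraInt M k.1) (latticeMomentum L k.2) *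
          ((∑ q : FreqMomentum L M, propCT L M β μ 0 q) / ((β * (L : ℝ) ^ 2 : ℝ) : ℂ))))) h0c hS1'
  have hsum : _ := klre_add
    (S := (fun (L M : ℕ) (_ : NeZero L) (_ : NeZero M) (k : FreqMomentum L M) (σ : Fin 2) =>
        klSelfEnergy L M β 0 μ K klE0 (nScales β + 1) k σ + (U : ℂ) * -(dsq (matsubaraInt M k.1) (latticeMomentum L k.2) *
          ((∑ q : FreqMomentum L M, propCT L M β μ 0 q) / ((β * (L : ℝ) ^ 2 : ℝ) : ℂ)))))
    (T := (fun (L M : ℕ) (_ : NeZero L) (_ : NeZero M) (k : FreqMomentum L M) (σ : Fin 2) =>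
        ((U ^ 2 / 2 : ℝ) : ℂ) * (2 * (dsq (matsubaraInt M k.1) (latticeMomentum L k.2) *
          (klSunset L M β g0 k σ -
            g0 (matsubaraInt M k.1) (latticeMomentum L k.2) *
              ((∑ q : FreqMomentum L M, propCT L M β μ 0 q) / ((β * (L : ℝ) ^ 2 : ℝ) : ℂ) *
                ((∑ q : FreqMomentum L M, propCT L M β μ 0 q) / ((β * (L : ℝ) ^ 2 : ℝ) : ℂ))) -
          (∑ q : FreqMomentum L M, propCT L M β μ 0 q) / ((β * (L : ℝ) ^ 2 : ℝ) : ℂ) *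
            ((∑ q : FreqMomentum L M, propCT L M β μ 0 q ^ 2) / ((β * (L : ℝ) ^ 2 : ℝ) : ℂ))))))) hsum1 hS2'
  obtain ⟨D, ρ, hρ, hrate⟩ := hsum
  refine ⟨Lc, Mc, D, ρ, hρ, fun L _ hL M _ hM L' _ hLL' M' _ hM' σ ω ω' hωω' k k' => ?_⟩
  have h := hrate L hL M hM L' hLL' M' hM' σ ω ω' hωω' k k'
  rw [klso_deriv_eq hβ μ K ω k σ, klso_deriv_deriv_eq hβ μ K ω k σ, klso_deriv_eq hβ μ K ω' k' σ,
    klso_deriv_deriv_eq hβ μ K ω' k' σ]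
  simp only [hg0, hdsq] at h
  convert h using 2
  ring

end Summit.HubbardSuperconductivity.HubbardSuperconductivity.Theorems.KLRegimeSplit

end
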